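import Summits.HubbardSuperconductivity.HubbardSuperconductivity.Theorems.JosephsonMirrorJmCuspAmgmConverse
import Summits.HubbardSuperconductivity.HubbardSuperconductivity.Theorems.JosephsonMirrorJmCuspDedoubleTools
import Summits.HubbardSuperconductivity.HubbardSuperconductivity.Theorems.JosephsonMirrorJmInterchangeHypGivesZEPO
import HarnessLib

/-!
# Route `JosephsonMirror` — crux `JmCusp` (stmt-HubbardSuperconductivity-2228): the universal gain cap

Support file (`--supports stmt-HubbardSuperconductivity-2228`) for the crux `JmCusp` of route
`JosephsonMirror` (sub-problem `HubbardSuperconductivity`). Clause (i) of the bet asks for a uniform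
LINEAR Josephson gain `a · J · L² ≤ E_L(0) - E_L(J)` of the window double
`H_L(J) = A ⊗ 1 + 1 ⊗ Aᵀ - J (D ⊗ D̄ + Dᴴ ⊗ D̄ᴴ)` (`A = H - μ_L N`, `D = L⁻¹ Δ_d`, `D̄ = (Dᴴ)ᵀ`) on
the mirror window `S_L`. This file calibrates the CONSTANT of the bet: for every `U`, every
`δ ∈ (0, 1/2)`, every `J ≥ 0` and every even `L`,

  `E_L(0) - E_L(J) ≤ 64 · J · L²`   (`josephsonGain_le_const`),

so the gain is never more than linear with a universal slope and the bet's constant is confined to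
`a ∈ (0, 64]` (`jmCusp_clauseI_false_of_const_gt`: clause (i) with `a > 64` fails at EVERY `(U, δ)`).
Steps (all ingredients in tree): the Kronecker AM–GM de-doubling
`josephsonGain_le_twoSectorGain` (`E(0) - E(J) ≤ max_{N'} [G(N')(ΔΔᴴ) + G(N')(ΔᴴΔ)]` with the
single-layer sector deformation gains `G(N')(Q) = e(N') - minEnergyOn (H - (J/L²) Q) (N', 0)`), the
Weyl-type sector bound `G(N')(Q) ≤ (J/L²) ‖Q‖` for a bounded deformation
(`minEnergyOn_sub_smul_ge`), and `‖Δ_d‖² ≤ 32 L⁴` (`norm_pairField_dWave_sq_le`).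
Sources: J.-B. Bru, W. de Siqueira Pedra, Rev. Math. Phys. 22 (2010) 233 (AM–GM operator inequality
of the approximating-Hamiltonian method); T. Koma, H. Tasaki, J. Stat. Phys. 76 (1994) 745
(variational two-sided bounds); H. Tasaki, *Physics and Mathematics of Quantum Many-Body Systems*
(2020) §2.1–2.2 (sector variational principle). No new definitions.
-/

-- the mandated namespace `Summit.<Summit>.<Problem>.Theorems` repeats `HubbardSuperconductivity`
-- (single-problem summit, D-0017), which the `dupNamespace` linter flags on every declaration
set_option linter.dupNamespace false

namespace Summit.HubbardSuperconductivity.HubbardSuperconductivity.Theorems.JosephsonMirror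

open Matrix Literature.MathematicalPhysics.QuantumLattice
open scoped Kronecker ComplexOrder Matrix.Norms.L2Operator

section Abstract

variable {n : Type*} [Fintype n] [DecidableEq n]

/-- **Weyl-type lower bound for a bounded deformation in a sector.** If the sector `K` holds a
unit vector, `Re ⟨v, Q v⟩ ≤ M ‖v‖²` for all `v`, and `c ≥ 0`, then
`minEnergyOn H K - c M ≤ minEnergyOn (H - c Q) K` (test the deformed problem with each unit
`ψ ∈ K`: `Re ⟨ψ, (H - cQ) ψ⟩ ≥ minEnergyOn H K - c M`). Tasaki (2020) §2.1. [folklore] -/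
theorem minEnergyOn_sub_smul_ge {H : Matrix n n ℂ} (hH : H.IsHermitian) (Q : Matrix n n ℂ)
    (K : Submodule ℂ (n → ℂ)) (hne : ∃ ψ ∈ K, star ψ ⬝ᵥ ψ = 1) {c M : ℝ} (hc : 0 ≤ c)
    (hQ : ∀ v : n → ℂ, (star v ⬝ᵥ Q *ᵥ v).re ≤ M * (star v ⬝ᵥ v).re) :
    H.minEnergyOn K - c * M ≤ (H - (c : ℂ) • Q).minEnergyOn K := by
  obtain ⟨ψ₀, hψ₀K, hψ₀⟩ := hne
  refine le_csInf ⟨_, ψ₀, hψ₀K, hψ₀, rfl⟩ ?_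
  rintro E ⟨ψ, hψK, hψ1, rfl⟩
  have h1 := minEnergyOn_le_rayleigh_of_mem hH K hψK hψ1
  have h2 := hQ ψ
  rw [hψ1, Complex.one_re, mul_one] at h2
  rw [sub_mulVec, dotProduct_sub, Complex.sub_re, smul_mulVec, dotProduct_smul, smul_eq_mul,
    Complex.re_ofReal_mul]
  nlinarith

/-- `Re ⟨v, X Xᴴ v⟩ = ‖Xᴴ v‖² ≤ ‖X‖² ‖v‖²` (`ℓ²` operator norm; `‖Xᴴ‖ = ‖X‖`). [folklore] -/
theorem re_star_dotProduct_mul_conjTranspose_mulVec_le (X : Matrix n n ℂ) (v : n → ℂ) :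
    (star v ⬝ᵥ (X * Xᴴ) *ᵥ v).re ≤ ‖X‖ ^ 2 * (star v ⬝ᵥ v).re := by
  have h := re_star_mulVec_self_le_opNorm_sq Xᴴ v
  rw [Matrix.l2_opNorm_conjTranspose, star_mulVec, conjTranspose_conjTranspose, ← dotProduct_mulVec,
    mulVec_mulVec] at h
  exact h

/-- `Re ⟨v, Xᴴ X v⟩ = ‖X v‖² ≤ ‖X‖² ‖v‖²` (`ℓ²` operator norm). [folklore] -/
theorem re_star_dotProduct_conjTranspose_mul_mulVec_le (X : Matrix n n ℂ) (v : n → ℂ) :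
    (star v ⬝ᵥ (Xᴴ * X) *ᵥ v).re ≤ ‖X‖ ^ 2 * (star v ⬝ᵥ v).re := by
  have h := re_star_dotProduct_mul_conjTranspose_mulVec_le Xᴴ v
  rwa [conjTranspose_conjTranspose, Matrix.l2_opNorm_conjTranspose] at h

end Abstract

section Torus

/-- **Single-layer sector deformation gains are at most `32 J L²`.** For the layer
`H = hubbardTorus 2 L 1 U`, the pair field `P = Δ_d` and the deformation strength `c = J / L²`
(`J ≥ 0`), in every sector `(2m, S^z = 0)` with `m ≤ L²`:
`e(2m) - minEnergyOn (H - c P Pᴴ) (2m, 0) ≤ 32 J L²` and the same for `Pᴴ P`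
(`minEnergyOn_sub_smul_ge` with `M = ‖Δ_d‖² ≤ 32 L⁴`, `norm_pairField_dWave_sq_le`; the sector holds a
unit ground state, `exists_unit_szSector_groundState`). Tasaki (2020) §2.1–2.2. [folklore] -/
theorem sectorDeformationGain_pairField_le (L : ℕ) [NeZero L] (U J : ℝ) (hJ : 0 ≤ J) {m : ℕ}
    (hm : m ≤ L ^ 2) :
    let H := hubbardTorus 2 L 1 U
    let P := pairField dWaveFormFactor L
    let c : ℂ := ((J / (L : ℝ) ^ 2 : ℝ) : ℂ)
    H.minEnergyOn (szSector (2 * m) 0) - (H - c • (P * Pᴴ)).minEnergyOn (szSector (2 * m) 0) ≤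
        32 * J * (L : ℝ) ^ 2 ∧
      H.minEnergyOn (szSector (2 * m) 0) - (H - c • (Pᴴ * P)).minEnergyOn (szSector (2 * m) 0) ≤
        32 * J * (L : ℝ) ^ 2 := by
  intro H P c
  have hHherm : H.IsHermitian := LiebThm1.hamiltonian_isHermitian (fermionTorusGraph 2 L) 1 U
  obtain ⟨φ, hφsec, hφ1, -⟩ := exists_unit_szSector_groundState L U hm
  have hne : ∃ ψ ∈ szSector (2 * m) 0, star ψ ⬝ᵥ ψ = 1 :=
    ⟨φ, (mem_szSector_two_mul_zero_iff m φ).2 hφsec, hφ1⟩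
  have hc : 0 ≤ J / (L : ℝ) ^ 2 := by positivity
  have hL : (L : ℝ) ≠ 0 := Nat.cast_ne_zero.2 (NeZero.ne L)
  have hM : ‖P‖ ^ 2 ≤ 32 * (L : ℝ) ^ 4 := norm_pairField_dWave_sq_le L
  have hL2 : (L : ℝ) ^ 2 ≠ 0 := pow_ne_zero 2 hL
  have hcM : J / (L : ℝ) ^ 2 * (32 * (L : ℝ) ^ 4) = 32 * J * (L : ℝ) ^ 2 := by
    calc J / (L : ℝ) ^ 2 * (32 * (L : ℝ) ^ 4)
        = 32 * J * (L : ℝ) ^ 2 * ((L : ℝ) ^ 2 / (L : ℝ) ^ 2) := by ring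
      _ = 32 * J * (L : ℝ) ^ 2 := by rw [div_self hL2, mul_one]
  have hQ₁ : ∀ v, (star v ⬝ᵥ (P * Pᴴ) *ᵥ v).re ≤ 32 * (L : ℝ) ^ 4 * (star v ⬝ᵥ v).re := fun v =>
    (re_star_dotProduct_mul_conjTranspose_mulVec_le P v).trans
      (mul_le_mul_of_nonneg_right hM (Complex.nonneg_iff.1 (dotProduct_star_self_nonneg v)).1)
  have hQ₂ : ∀ v, (star v ⬝ᵥ (Pᴴ * P) *ᵥ v).re ≤ 32 * (L : ℝ) ^ 4 * (star v ⬝ᵥ v).re := fun v =>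
    (re_star_dotProduct_conjTranspose_mul_mulVec_le P v).trans
      (mul_le_mul_of_nonneg_right hM (Complex.nonneg_iff.1 (dotProduct_star_self_nonneg v)).1)
  have h₁ := minEnergyOn_sub_smul_ge hHherm (P * Pᴴ) (szSector (2 * m) 0) hne hc hQ₁
  have h₂ := minEnergyOn_sub_smul_ge hHherm (Pᴴ * P) (szSector (2 * m) 0) hne hc hQ₂
  rw [hcM] at h₁ h₂
  exact ⟨by linarith, by linarith⟩

/-- **The universal gain cap of the window double** (calibration of the constant in clause (i) of
the crux `JmCusp`, stmt-HubbardSuperconductivity-2228; let-telescope of the route decl verbatim): for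
every `U`, `δ ∈ (0, 1/2)`, `J ≥ 0` and even `L`, `E_L(0) - E_L(J) ≤ 64 · J · L²`. Proof: the Kronecker
AM–GM de-doubling `josephsonGain_le_twoSectorGain` bounds the Josephson gain by the better window
sector's `G(N')(Δ_dΔ_dᴴ) + G(N')(Δ_dᴴΔ_d)`, `N' ∈ {N_L, N_L - 2}`, and each single-layer sector
deformation gain is at most `32 J L²` (`sectorDeformationGain_pairField_le`). Bru–de Siqueira Pedra,
Rev. Math. Phys. 22 (2010) 233; Koma–Tasaki, J. Stat. Phys. 76 (1994) 745. [folklore] -/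
theorem josephsonGain_le_const : ∀ (L : ℕ) [NeZero L] (U δ J : ℝ), Even L → δ ∈ Set.Ioo (0:ℝ) (1 / 2) → 0 ≤ J → (let ι : Type := Finset (Literature.MathematicalPhysics.QuantumLattice.Orb (Literature.MathematicalPhysics.QuantumLattice.FermionTorus 2 L)); let N : ℕ := 2 * ⌊(1 - δ) * (L : ℝ) ^ 2 / 2⌋₊; let H : Matrix ι ι ℂ := Literature.MathematicalPhysics.QuantumLattice.hubbardTorus 2 L 1 U; let μ : ℝ := (H.minEnergyOn (Literature.MathematicalPhysics.QuantumLattice.szSector N 0) - H.minEnergyOn (Literature.MathematicalPhysics.QuantumLattice.szSector (N - 2) 0)) / 2; let A : Matrix ι ι ℂ := Literature.MathematicalPhysics.QuantumLattice.hubbardTorusWith 2 L 1 U μ; let D : Matrix ι ι ℂ := ((L : ℂ))⁻¹ • Literature.MathematicalPhysics.QuantumLattice.pairField Literature.MathematicalPhysics.QuantumLattice.dWaveFormFactor L; let Hd : ℝ → Matrix (ι × ι) (ι × ι) ℂ := fun J => Matrix.kroneckerMap (fun a b : ℂ => a * b) A 1 + Matrix.kroneckerMap (fun a b : ℂ =>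 a * b) 1 (Matrix.transpose A) - (J : ℂ) • (Matrix.kroneckerMap (fun a b : ℂ => a * b) D (Matrix.transpose (Matrix.conjTranspose D)) + Matrix.kroneckerMap (fun a b : ℂ => a * b) (Matrix.conjTranspose D) (Matrix.transpose D)); let good : ι × ι → Prop := fun p => ((p.1.card = N ∧ p.2.card = N) ∨ (p.1.card = N - 2 ∧ p.2.card = N - 2)) ∧ (p.1.filter (fun o => (ofLex o).2 = 0)).card = (p.1.filter (fun o => (ofLex o).2 = 1)).card ∧ (p.2.filter (fun o => (ofLex o).2 = 0)).card = (p.2.filter (fun o => (ofLex o).2 = 1)).card; let S : Submodule ℂ (ι × ι → ℂ) := ⨅ (p : ι × ι) (_ : ¬ good p), LinearMap.ker (LinearMap.proj (R := ℂ) (φ := fun _ : ι × ι => ℂ) p); let E : ℝ → ℝ := fun J => (Hd J).minEnergyOn S; E 0 - E J ≤ 64 * J * (L : ℝ) ^ 2) := by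
  intro L _ U δ J hE hδ hJ ι N H μ A D Hd good S E
  -- the filling: `N = 2n`, `N - 2 = 2(n - 1)` with `n ≤ L²`
  set n : ℕ := ⌊(1 - δ) * (L : ℝ) ^ 2 / 2⌋₊ with hn
  have hNn : N = 2 * n := rfl
  have hnL : n ≤ L ^ 2 := by
    refine hn ▸ Nat.floor_le_of_le ?_
    have hL0 : (0 : ℝ) ≤ (L : ℝ) ^ 2 := by positivity
    push_cast
    nlinarith [hδ.1]
  have hN2 : N - 2 = 2 * (n - 1) := by omega
  have hn1L : n - 1 ≤ L ^ 2 := le_trans (Nat.sub_le n 1) hnL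
  have key := josephsonGain_le_twoSectorGain L U δ J hE hδ hJ
  obtain ⟨h₁, h₂⟩ := sectorDeformationGain_pairField_le L U J hJ hnL
  obtain ⟨h₃, h₄⟩ := sectorDeformationGain_pairField_le L U J hJ hn1L
  rw [← hNn] at h₁ h₂
  rw [← hN2] at h₃ h₄
  refine key.trans (max_le ?_ ?_)
  · show H.minEnergyOn (szSector N 0) - (H - (((J / (L : ℝ) ^ 2 : ℝ) : ℂ)) •
        (pairField dWaveFormFactor L * (pairField dWaveFormFactor L)ᴴ)).minEnergyOn (szSector N 0) +
      (H.minEnergyOn (szSector N 0) - (H - (((J / (L : ℝ) ^ 2 : ℝ) : ℂ)) •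
        ((pairField dWaveFormFactor L)ᴴ * pairField dWaveFormFactor L)).minEnergyOn (szSector N 0)) ≤
      64 * J * (L : ℝ) ^ 2
    linarith
  · show H.minEnergyOn (szSector (N - 2) 0) - (H - (((J / (L : ℝ) ^ 2 : ℝ) : ℂ)) •
        (pairField dWaveFormFactor L * (pairField dWaveFormFactor L)ᴴ)).minEnergyOn
          (szSector (N - 2) 0) +
      (H.minEnergyOn (szSector (N - 2) 0) - (H - (((J / (L : ℝ) ^ 2 : ℝ) : ℂ)) •
        ((pairField dWaveFormFactor L)ᴴ * pairField dWaveFormFactor L)).minEnergyOn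
          (szSector (N - 2) 0)) ≤
      64 * J * (L : ℝ) ^ 2
    linarith

/-- **Clause (i) of `JmCusp` with a constant `a > 64` is false at every `(U, δ)`** (a refuted
strengthening of the bet, uniformly in the coupling and the doping): the uniform linear Josephson gain
`a · J · L² ≤ E_L(0) - E_L(J)` on `(0, J₀]`, eventually in even `L`, is incompatible with the universal
cap `E_L(0) - E_L(J) ≤ 64 · J · L²` (`josephsonGain_le_const`) as soon as `a > 64` (test `J = J₀` at
any admissible even `L ≥ max L₀ 2`). So the witness constant of the bet necessarily lies in `(0, 64]`.
Koma–Tasaki, J. Stat. Phys. 76 (1994) 745. [folklore] -/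
theorem jmCusp_clauseI_false_of_const_gt : ∀ (U δ a J₀ : ℝ), δ ∈ Set.Ioo (0:ℝ) (1 / 2) → 64 < a → 0 < J₀ → ¬ (∀ J ∈ Set.Ioc (0:ℝ) J₀, ∃ L₀ : ℕ, ∀ (L : ℕ) [NeZero L], Even L → L₀ ≤ L → (let ι : Type := Finset (Literature.MathematicalPhysics.QuantumLattice.Orb (Literature.MathematicalPhysics.QuantumLattice.FermionTorus 2 L)); let N : ℕ := 2 * ⌊(1 - δ) * (L : ℝ) ^ 2 / 2⌋₊; let H : Matrix ι ι ℂ := Literature.MathematicalPhysics.QuantumLattice.hubbardTorus 2 L 1 U; let μ : ℝ := (H.minEnergyOn (Literature.MathematicalPhysics.QuantumLattice.szSector N 0) - H.minEnergyOn (Literature.MathematicalPhysics.QuantumLattice.szSector (N - 2) 0)) / 2; let A : Matrix ι ι ℂ := Literature.MathematicalPhysics.QuantumLattice.hubbardTorusWith 2 L 1 U μ; let D : Matrix ι ι ℂ := ((L : ℂ))⁻¹ • Literature.MathematicalPhysics.QuantumLattice.pairField Literature.MathematicalPhysics.QuantumLattice.dWaveFormFactor L; let Hd : ℝ → Matrix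 (ι × ι) (ι × ι) ℂ := fun J => Matrix.kroneckerMap (fun a b : ℂ => a * b) A 1 + Matrix.kroneckerMap (fun a b : ℂ => a * b) 1 (Matrix.transpose A) - (J : ℂ) • (Matrix.kroneckerMap (fun a b : ℂ => a * b) D (Matrix.transpose (Matrix.conjTranspose D)) + Matrix.kroneckerMap (fun a b : ℂ => a * b) (Matrix.conjTranspose D) (Matrix.transpose D)); let good : ι × ι → Prop := fun p => ((p.1.card = N ∧ p.2.card = N) ∨ (p.1.card = N - 2 ∧ p.2.card = N - 2)) ∧ (p.1.filter (fun o => (ofLex o).2 = 0)).card = (p.1.filter (fun o => (ofLex o).2 = 1)).card ∧ (p.2.filter (fun o => (ofLex o).2 = 0)).card = (p.2.filter (fun o => (ofLex o).2 = 1)).card; let S : Submodule ℂ (ι × ι → ℂ) := ⨅ (p : ι × ι) (_ : ¬ good p), LinearMap.ker (LinearMap.proj (R := ℂ) (φ := fun _ : ι × ι => ℂ) p); let E : ℝ → ℝ := fun J => (Hd J).minEnergyOn S; a * J * (L : ℝ) ^ 2 ≤ E 0 - E J)) := by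
  intro U δ a J₀ hδ ha hJ₀ hgain
  obtain ⟨L₀, hL₀⟩ := hgain J₀ ⟨hJ₀, le_rfl⟩
  -- an admissible even side `L = 2 (L₀ + 1) ≥ L₀`
  have hL : L₀ ≤ 2 * (L₀ + 1) := by omega
  haveI : NeZero (2 * (L₀ + 1)) := ⟨by omega⟩
  have hlow := hL₀ (2 * (L₀ + 1)) (even_two_mul _) hL
  have hcap := josephsonGain_le_const (2 * (L₀ + 1)) U δ J₀ (even_two_mul _) hδ hJ₀.le
  have hpos : (0 : ℝ) < J₀ * ((2 * (L₀ + 1) : ℕ) : ℝ) ^ 2 := by positivity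
  have h : a * J₀ * ((2 * (L₀ + 1) : ℕ) : ℝ) ^ 2 ≤ 64 * J₀ * ((2 * (L₀ + 1) : ℕ) : ℝ) ^ 2 :=
    le_trans hlow hcap
  nlinarith

end Torus

end Summit.HubbardSuperconductivity.HubbardSuperconductivity.Theorems.JosephsonMirror
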